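import Literature.AlgebraicGeometry.Modules.LocalFrames
import Mathlib.LinearAlgebra.Matrix.Determinant.Basic
import Mathlib.LinearAlgebra.Matrix.ToLin
import Mathlib.LinearAlgebra.InvariantBasisNumber
import Mathlib.LinearAlgebra.Dimension.StrongRankCondition
import Mathlib.RingTheory.MatrixAlgebra
import HarnessLib

/-!
# Transition matrices between local frames of an `𝒪_X`-module and their determinants

For an `𝒪_X`-module `E` on a scheme `X` and two trivialisations ("frames")
`e : 𝒪^I ≅ E|_W`, `e' : 𝒪^{I'} ≅ E|_{W'}` (Mathlib's `SheafOfModules.free I ≅ E.over W`, the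
carrier of the tree's `Literature.AlgebraicGeometry.Motives.IsFiniteLocallyFree`), with basis
sections `b_i`, `b'_j` (`basisSection`, `Modules/SheafHomExact.lean`) and coordinates `λ_i`
(`coord`, `Modules/LocalFrames.lean`), we define over any open `V ≤ W ⊓ W'`

* `transition e e' k k' : Matrix I I' Γ(X, V)`, `(i, j) ↦ λ_i(b'_j|_V)` — the **transition matrix**
  (`b'_j|_V = ∑_i T_{ij} b_i|_V`, `map_basisSection_eq_sum_transition`), with the cocycle identities
  `T(e,e) = 1` (`transition_self`), `T(e,e') T(e',e'') = T(e,e'')` (`transition_mul`) and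
  compatibility with restriction (`transition_map`);
* `stdTransition e e' ε ε'` — the same matrix reindexed by enumerations `ε : I ≃ Fin n`,
  `ε' : I' ≃ Fin n'`, and `transitionDet e e' ε ε' k k' ∈ Γ(X, V)` — its **determinant** when
  `n = n'` (and `1` otherwise; over a non-empty `V` two frames have the same size,
  `rank_eq_of_nontrivial`), again a multiplicative cocycle of units (`transitionDet_mul`,
  `transitionDet_self`, `isUnit_transitionDet`) compatible with restriction (`transitionDet_map`).

These are the transition functions `g_{αβ} = det(ψ_α ∘ ψ_β⁻¹)` of the determinant line bundle
(Hartshorne II Ex. 5.16 (d)/(e), II.6 p. 143 "transition functions"; Fulton §15.1 / B.3) in the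
Čech form used by `Modules/DeterminantCocycle.lean`. Everything is proved; no named facts.

## References

* R. Hartshorne, *Algebraic Geometry*, GTM 52 (1977), II.5 and II Ex. 5.16. [Hartshorne1977]
* W. Fulton, *Intersection theory*, 2nd ed. (1998), §15.1, B.3. [Fulton1998]
-/

noncomputable section

open CategoryTheory AlgebraicGeometry Opposite TopologicalSpace Limits

namespace Literature.AlgebraicGeometry.Modules

open Literature.AlgebraicGeometry.Motives

universe u

variable {X : Scheme.{u}} {E : X.Modules} {W W' W'' V V' : X.Opens} {I I' I'' : Type u}

/-! ### Calculus of coordinates in a frame -/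

section Coord

variable (e : SheafOfModules.free I ≅ E.over W)

/-- Coordinates are additive. [folklore] -/
lemma coord_add (k : V ⟶ W) (s t : Γ(E, V)) (i : I) :
    coord e k (s + t) i = coord e k s i + coord e k t i :=
  appLE_add_right _ k s t

/-- Coordinates are `𝒪_X(V)`-linear. [folklore] -/
lemma coord_smul (k : V ⟶ W) (r : Γ(X, V)) (s : Γ(E, V)) (i : I) :
    coord e k (r • s) i = r * coord e k s i :=
  appLE_smul_right _ k r s

/-- Coordinates of `0` vanish. [folklore] -/
@[simp]
lemma coord_zero (k : V ⟶ W) (i : I) : coord e k (0 : Γ(E, V)) i = 0 :=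
  appLE_zero_right _ k

/-- Coordinates of a finite sum. [folklore] -/
lemma coord_sum {ι : Type*} (t : Finset ι) (k : V ⟶ W) (s : ι → Γ(E, V)) (i : I) :
    coord e k (∑ a ∈ t, s a) i = ∑ a ∈ t, coord e k (s a) i :=
  appLE_sum_right t _ k s

/-- Coordinates commute with restriction: `λ_i(s|_{V'}) = λ_i(s)|_{V'}`. [folklore] -/
lemma coord_map (k : V ⟶ W) (l : V' ⟶ V) (s : Γ(E, V)) (i : I) :
    coord e (l ≫ k) (E.presheaf.map l.op s) i = X.presheaf.map l.op (coord e k s i) :=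
  appLE_map (dualBasis e i) k l s

/-- Coordinates of the restricted basis sections: `λ_i(b_j|_V) = δ_{ij}`. [folklore] -/
lemma coord_map_basisSection [DecidableEq I] (k : V ⟶ W) (i j : I) :
    coord e k (E.presheaf.map k.op (basisSection e j)) i = if j = i then 1 else 0 := by
  have h := coord_map e (𝟙 W) k (basisSection e j) i
  rw [Subsingleton.elim (k ≫ 𝟙 W) k, coord_basisSection] at h
  rw [h]
  split_ifs with hij
  · exact map_one (X.presheaf.map k.op).hom
  · exact map_zero (X.presheaf.map k.op).hom

/-- **Uniqueness of coordinates**: the coordinates of `∑_i c_i b_i|_V` are the `c_i`. [folklore] -/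
lemma coord_sum_smul_basisSection [Fintype I] (k : V ⟶ W) (c : I → Γ(X, V)) (j : I) :
    coord e k (∑ i, c i • E.presheaf.map k.op (basisSection e i)) j = c j := by
  classical
  rw [coord_sum]
  simp_rw [coord_smul, coord_map_basisSection, mul_ite, mul_one, mul_zero, Finset.sum_ite_eq',
    Finset.mem_univ, if_true]

/-- Two sections over `V ≤ W` with the same coordinates in a frame of `E|_W` are equal.
[folklore] -/
lemma ext_of_coord [Fintype I] (k : V ⟶ W) {s t : Γ(E, V)}
    (h : ∀ i, coord e k s i = coord e k t i) : s = t := by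
  rw [eq_sum_coord_smul e k s, eq_sum_coord_smul e k t]
  exact Finset.sum_congr rfl fun i _ => by rw [h i]

end Coord

/-! ### Transition matrices -/

section Transition

variable (e : SheafOfModules.free I ≅ E.over W) (e' : SheafOfModules.free I' ≅ E.over W')
  (e'' : SheafOfModules.free I'' ≅ E.over W'')

/-- **The transition matrix** of two frames `e : 𝒪^I ≅ E|_W`, `e' : 𝒪^{I'} ≅ E|_{W'}` over an
open `V` below `W` and `W'`: `T_{ij} = λ_i(b'_j|_V)`, the `i`-th coordinate in the frame `e` of
the `j`-th basis section of `e'` (Hartshorne II.5: change of basis of a free module; the matrix of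
`e⁻¹ ∘ e'` over `V`). [folklore] -/
def transition (k : V ⟶ W) (k' : V ⟶ W') : Matrix I I' Γ(X, V) :=
  Matrix.of fun i j => coord e k (E.presheaf.map k'.op (basisSection e' j)) i

/-- Entries of the transition matrix. [folklore] -/
lemma transition_apply (k : V ⟶ W) (k' : V ⟶ W') (i : I) (j : I') :
    transition e e' k k' i j = coord e k (E.presheaf.map k'.op (basisSection e' j)) i := rfl

/-- **Basis change**: `b'_j|_V = ∑_i T_{ij} b_i|_V`. [folklore] -/
lemma map_basisSection_eq_sum_transition [Fintype I] (k : V ⟶ W) (k' : V ⟶ W') (j : I') :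
    E.presheaf.map k'.op (basisSection e' j) =
      ∑ i, transition e e' k k' i j • E.presheaf.map k.op (basisSection e i) :=
  eq_sum_coord_smul e k _

/-- The transition matrix is compatible with restriction to a smaller open. [folklore] -/
lemma transition_map (k : V ⟶ W) (k' : V ⟶ W') (l : V' ⟶ V) :
    (transition e e' k k').map (X.presheaf.map l.op).hom = transition e e' (l ≫ k) (l ≫ k') := by
  ext i j
  rw [Matrix.map_apply, transition_apply, transition_apply]
  change X.presheaf.map l.op _ = _
  rw [← coord_map, presheaf_map_map]

/-- The transition matrix of a frame to itself is the identity. [folklore] -/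
lemma transition_self [DecidableEq I] (k : V ⟶ W) : transition e e k k = 1 := by
  ext i j
  rw [transition_apply, coord_map_basisSection, Matrix.one_apply]
  exact if_congr eq_comm rfl rfl

/-- **Cocycle identity** `T(e,e') T(e',e'') = T(e,e'')` over a common open. [folklore] -/
lemma transition_mul [Fintype I] [Fintype I'] (k : V ⟶ W) (k' : V ⟶ W') (k'' : V ⟶ W'') :
    transition e e' k k' * transition e' e'' k' k'' = transition e e'' k k'' := by
  ext i l
  rw [Matrix.mul_apply, transition_apply]
  -- expand `b''_l` in the frame `e'`, then each `b'_j` in the frame `e`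
  have h := map_basisSection_eq_sum_transition e' e'' k' k'' l
  conv_rhs => rw [h, coord_sum]
  refine Finset.sum_congr rfl fun j _ => ?_
  rw [coord_smul, map_basisSection_eq_sum_transition e e' k k' j, coord_sum_smul_basisSection,
    mul_comm, transition_apply]

/-- `T(e,e') T(e',e) = 1`. [folklore] -/
lemma transition_mul_symm [Fintype I] [Fintype I'] [DecidableEq I] (k : V ⟶ W) (k' : V ⟶ W') :
    transition e e' k k' * transition e' e k' k = 1 := by
  rw [transition_mul, transition_self]

end Transition

/-! ### Enumerated frames: square transition matrices and their determinants -/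

section Std

variable (e : SheafOfModules.free I ≅ E.over W) (e' : SheafOfModules.free I' ≅ E.over W')
  (e'' : SheafOfModules.free I'' ≅ E.over W'') {n n' n'' : ℕ} (ε : I ≃ Fin n) (ε' : I' ≃ Fin n')
  (ε'' : I'' ≃ Fin n'')

/-- The transition matrix reindexed by enumerations `ε : I ≃ Fin n`, `ε' : I' ≃ Fin n'` of the two
frames. [folklore] -/
def stdTransition (k : V ⟶ W) (k' : V ⟶ W') : Matrix (Fin n) (Fin n') Γ(X, V) :=
  (transition e e' k k').submatrix ε.symm ε'.symm

/-- Entries of the reindexed transition matrix. [folklore] -/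
lemma stdTransition_apply (k : V ⟶ W) (k' : V ⟶ W') (a : Fin n) (b : Fin n') :
    stdTransition e e' ε ε' k k' a b = transition e e' k k' (ε.symm a) (ε'.symm b) := rfl

/-- The reindexed transition matrix is compatible with restriction. [folklore] -/
lemma stdTransition_map (k : V ⟶ W) (k' : V ⟶ W') (l : V' ⟶ V) :
    (stdTransition e e' ε ε' k k').map (X.presheaf.map l.op).hom =
      stdTransition e e' ε ε' (l ≫ k) (l ≫ k') := by
  rw [stdTransition, stdTransition, ← transition_map, Matrix.submatrix_map]

/-- `stdTransition e e = 1`. [folklore] -/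
lemma stdTransition_self (k : V ⟶ W) : stdTransition e e ε ε k k = 1 := by
  classical
  rw [stdTransition, transition_self, Matrix.submatrix_one_equiv]

/-- The cocycle identity for reindexed transition matrices. [folklore] -/
lemma stdTransition_mul (k : V ⟶ W) (k' : V ⟶ W') (k'' : V ⟶ W'') :
    stdTransition e e' ε ε' k k' * stdTransition e' e'' ε' ε'' k' k'' =
      stdTransition e e'' ε ε'' k k'' := by
  haveI : Fintype I := Fintype.ofEquiv _ ε.symm
  haveI : Fintype I' := Fintype.ofEquiv _ ε'.symm
  rw [stdTransition, stdTransition, stdTransition, ← transition_mul e e' e'' k k' k'',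
    Matrix.submatrix_mul _ _ _ _ _ ε'.symm.bijective]

/-- `stdTransition e e' * stdTransition e' e = 1`. [folklore] -/
lemma stdTransition_mul_symm (k : V ⟶ W) (k' : V ⟶ W') :
    stdTransition e e' ε ε' k k' * stdTransition e' e ε' ε k' k = 1 := by
  rw [stdTransition_mul, stdTransition_self]

include e e' ε ε' in
/-- **Two frames over a non-empty open have the same size**: if `Γ(X, V)` is a non-trivial ring
and `E|_V` is free on `n` and on `n'` basis sections then `n = n'` (invariant basis number of
non-trivial commutative rings, via the mutually inverse transition matrices). [folklore] -/
theorem rank_eq_of_nontrivial [Nontrivial Γ(X, V)] (k : V ⟶ W) (k' : V ⟶ W') : n = n' := by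
  have h₁ := stdTransition_mul_symm e e' ε ε' k k'
  have h₂ := stdTransition_mul_symm e' e ε' ε k' k
  -- the linear equivalence `(Fin n' → R) ≃ₗ (Fin n → R)` given by the two matrices
  let f : (Fin n' → Γ(X, V)) →ₗ[Γ(X, V)] (Fin n → Γ(X, V)) :=
    Matrix.toLin' (stdTransition e e' ε ε' k k')
  let g : (Fin n → Γ(X, V)) →ₗ[Γ(X, V)] (Fin n' → Γ(X, V)) :=
    Matrix.toLin' (stdTransition e' e ε' ε k' k)
  have hfg : f.comp g = LinearMap.id := by
    rw [← Matrix.toLin'_mul, h₁, Matrix.toLin'_one]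
  have hgf : g.comp f = LinearMap.id := by
    rw [← Matrix.toLin'_mul, h₂, Matrix.toLin'_one]
  let L : (Fin n' → Γ(X, V)) ≃ₗ[Γ(X, V)] (Fin n → Γ(X, V)) := LinearEquiv.ofLinear f g hfg hgf
  have h := L.finrank_eq
  rw [Module.finrank_fin_fun, Module.finrank_fin_fun] at h
  exact h.symm

/-- **The determinant of the transition matrix** of two enumerated frames over `V`, when they
have the same size `n = n'` (the transition function `det(e⁻¹ ∘ e')` of the determinant line
bundle, Hartshorne II Ex. 5.16); set to `1` when `n ≠ n'`, which only happens over an open `V`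
with `Γ(X, V) = 0` (`rank_eq_of_nontrivial`). [cite: Hartshorne1977, II Ex. 5.16] -/
def transitionDet (k : V ⟶ W) (k' : V ⟶ W') : Γ(X, V) :=
  if h : n = n' then
    (Matrix.of fun a b : Fin n => stdTransition e e' ε ε' k k' a (Fin.cast h b)).det
  else 1

/-- Unfolding `transitionDet` for frames of the same size. [folklore] -/
lemma transitionDet_eq (ε' : I' ≃ Fin n) (k : V ⟶ W) (k' : V ⟶ W') :
    transitionDet e e' ε ε' k k' = (stdTransition e e' ε ε' k k').det := by
  rw [transitionDet, dif_pos rfl]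
  rfl

/-- Unfolding `transitionDet` along an equality of sizes. [folklore] -/
lemma transitionDet_of_eq (h : n = n') (k : V ⟶ W) (k' : V ⟶ W') :
    transitionDet e e' ε ε' k k' =
      (Matrix.of fun a b : Fin n => stdTransition e e' ε ε' k k' a (Fin.cast h b)).det := by
  rw [transitionDet, dif_pos h]

/-- `transitionDet` is compatible with restriction. [folklore] -/
lemma transitionDet_map (k : V ⟶ W) (k' : V ⟶ W') (l : V' ⟶ V) :
    X.presheaf.map l.op (transitionDet e e' ε ε' k k') =
      transitionDet e e' ε ε' (l ≫ k) (l ≫ k') := by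
  unfold transitionDet
  split_ifs with h
  · subst h
    change (X.presheaf.map l.op).hom _ = _
    rw [RingHom.map_det, RingHom.mapMatrix_apply, ← stdTransition_map]
    rfl
  · exact map_one (X.presheaf.map l.op).hom

/-- `transitionDet e e = 1`. [folklore] -/
@[simp]
lemma transitionDet_self (k : V ⟶ W) : transitionDet e e ε ε k k = 1 := by
  rw [transitionDet_eq, stdTransition_self, Matrix.det_one]

/-- **Cocycle identity for determinants**: `det T(e,e') · det T(e',e'') = det T(e,e'')` over a
common open `V` (over `V` with `Γ(X, V) = 0` trivially; otherwise all three frames have the same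
size and this is multiplicativity of `det`). [folklore] -/
theorem transitionDet_mul (k : V ⟶ W) (k' : V ⟶ W') (k'' : V ⟶ W'') :
    transitionDet e e' ε ε' k k' * transitionDet e' e'' ε' ε'' k' k'' =
      transitionDet e e'' ε ε'' k k'' := by
  rcases subsingleton_or_nontrivial Γ(X, V) with hV | hV
  · exact Subsingleton.elim _ _
  · obtain rfl : n = n' := rank_eq_of_nontrivial e e' ε ε' k k'
    obtain rfl : n = n'' := rank_eq_of_nontrivial e e'' ε ε'' k k''
    rw [transitionDet_eq, transitionDet_eq, transitionDet_eq, ← Matrix.det_mul, stdTransition_mul]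

/-- `det T(e,e') · det T(e',e) = 1`. [folklore] -/
lemma transitionDet_mul_symm (k : V ⟶ W) (k' : V ⟶ W') :
    transitionDet e e' ε ε' k k' * transitionDet e' e ε' ε k' k = 1 := by
  rw [transitionDet_mul, transitionDet_self]

/-- The determinant of a transition matrix is a unit. [folklore] -/
lemma isUnit_transitionDet (k : V ⟶ W) (k' : V ⟶ W') :
    IsUnit (transitionDet e e' ε ε' k k') :=
  IsUnit.of_mul_eq_one _ (transitionDet_mul_symm e e' ε ε' k k')

/-- `transitionDet` does not depend on the names of the inclusions `V ≤ W`, `V ≤ W'`. [folklore] -/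
lemma transitionDet_congr_hom (k₁ k₂ : V ⟶ W) (k'₁ k'₂ : V ⟶ W') :
    transitionDet e e' ε ε' k₁ k'₁ = transitionDet e e' ε ε' k₂ k'₂ := by
  rw [Subsingleton.elim k₁ k₂, Subsingleton.elim k'₁ k'₂]

end Std

end Literature.AlgebraicGeometry.Modules

end
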